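/-
Copyright (c) 2026. All rights reserved.
Released under Apache 2.0 license as described in the file LICENSE.
Authors: abc-iut cell, prover seat abc-iut-L4-t12 (gen 7).
-/
import Literature.AnabelianGeometry.AbsoluteAnabelian.ArchimedeanHolFieldFunctorGeometricCovers
import Literature.Topology.CoveringSpaces.CoveringGaloisCorrespondenceFinite
import Literature.Topology.CoveringSpaces.CoveringMapOfComp
import HarnessLib

/-!
# [AbsTopIII] §4: the slice of `HolRS` over `𝕏` is equivalent to the connected finite covers of `𝕏^top`

PROOF-ONLY (plus packaging `def`s) sequel of `ArchimedeanHolFieldFunctorGeometricCovers.lean`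
(abc-iut cell, campaign-L item R1.2 of the geometric `EA` column of [AbsTopIII] Prop 4.2 / Cor 4.5;
classical).  S. Mochizuki, *Topics in Absolute Anabelian Geometry III*, proof of Prop 4.2, kurims p.106
l.11–19 («the full subcategory of `EA` consisting of objects that map to `X` may, by Corollary 2.3, (i),
… be identified with the category of finite étale R-localizations `Loc_R(X)`»).  For abc-iut-L4-t14's
model `HolRS` (connected Hausdorff Riemann surfaces, holomorphic finite étale maps) and the cell's
category `CovFin X` of finite covering spaces of a topological space (abc-iut-w5-d144,
`Literature/Topology/CoveringSpaces/CoveringGaloisCorrespondenceFinite.lean`: full subcategory of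
`Over (TopCat.of X)` on covering maps with finite fibres) we package the dictionary of the previous file
as a functor and prove:

* `HolRS.overToCovFin 𝕏 : Over 𝕏 ⥤ CovFin 𝕏.carrier` — forget the complex structure: an object
  `𝕐 → 𝕏` of the SLICE category goes to the finite covering space `𝕐^top → 𝕏^top`, a morphism over
  `𝕏` to its underlying continuous map;
* `HolRS.overToCovFin_faithful`, `HolRS.overToCovFin_full`, `HolRS.overToCovFinFullyFaithful` —
  **fully faithful**: a continuous map over `𝕏^top` between the underlying covers is a covering map
  (the tree's `IsCoveringMap.of_comp_eq`, Hatcher Ex. 1.3.16, over the locally connected `𝕏^top`) with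
  finite fibres, and is holomorphic by rigidity (`HolRS.homOfOver`), hence comes from a unique morphism
  of the slice;
* `HolRS.mem_essImage_overToCovFin_iff` — **essential image = the connected covers**: `E : CovFin 𝕏^top`
  is isomorphic to the image of an object over `𝕏` iff its total space is connected (`HolRS.ofCover`
  gives the object; connectedness transports along isomorphisms of covers);
* `HolRS.IsConnectedCover`, `HolRS.overToConnectedCovFin`, `HolRS.overToConnectedCovFin_isEquivalence` —
  **`Over 𝕏 ≌ {connected objects of CovFin 𝕏^top}`** (the lifted functor is fully faithful and
  essentially surjective).

Consequently categorical statements about connected finite covering spaces of `𝕏^top` OVER `𝕏^top`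
(the cell's topological Galois correspondence `CovFin X ≌ B(π̂₁(X, x₀))` and its id-rigidity
consequences, abc-iut-w5-d144 `CoveringIdRigid.lean`) transfer verbatim to the slice of `HolRS` over
`𝕏`.  CAVEAT (print's wording, cf. the previous file): print's «full subcategory of objects that map to
`X`» has ALL finite étale morphisms, not only those over `X`; that larger category is the subject of
abc-iut-L4-t14's `LocCategoryGroupModel.lean`.  HONEST SCOPE: classical; no orbicurves, no
uniformisation, no slimness; nothing here bears on [IUTchIII] Cor. 3.12.  Definitions: the functor, its
`FullyFaithful` structure, the object property «connected total space», the lifted functor — packaging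
only; no instances of mathematical content, no Prop facts.

## References

* S. Mochizuki, *Topics in Absolute Anabelian Geometry III*, kurims ms, Def 4.1 (i) p.101, (iii) p.103;
  proof of Prop 4.2 p.106 l.11–19. [MochizukiAbsTopIII2015]
* A. Hatcher, *Algebraic Topology*, CUP (2002), §1.3 p.67–70 (the category of covering spaces of `X`),
  Exercise 1.3.16. [HatcherAT2002]
* I-Hsiung Lin, *Classical complex analysis: a geometric approach*, vol. 2, World Scientific (2011),
  (7.5.2.1) p.449. [Lin2011]
-/

noncomputable section

open Set Function Topology CategoryTheory
open Literature.Geometry.Kaehler Literature.Topology.CoveringSpaces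

namespace Literature.AnabelianGeometry.AbsoluteAnabelian

namespace HolRS

variable (X : HolRS)

/-! ### §1 The forgetful functor from the slice over `𝕏` to finite covers of `𝕏^top` -/

/-- The underlying map of the structure morphism of an object of the slice `Over 𝕏`, composed with a
morphism of the slice, is the structure map of the source (pointwise form of `Over.w`).
[cite: MochizukiAbsTopIII2015, Definition 4.1 (iii) p.103] -/
theorem over_w_apply {Y Z : Over X} (g : Y ⟶ Z) (y : Y.left.carrier) :
    Z.hom.toFun (g.left.toFun y) = Y.hom.toFun y := by
  have h := congrArg Hom.toFun (Over.w g)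
  rw [comp_toFun] at h
  exact congrFun h y

/-- **The forgetful functor `Over 𝕏 ⥤ CovFin 𝕏^top`**: an object `f : 𝕐 → 𝕏` of the slice of `HolRS`
over `𝕏` is sent to the finite covering space `f^top : 𝕐^top → 𝕏^top` (a morphism of `HolRS` is a
covering map with finite fibres by definition), a morphism over `𝕏` to its underlying continuous map.
[cite: MochizukiAbsTopIII2015, proof of Proposition 4.2, p.106 l.11–19] [cite: HatcherAT2002, §1.3 p.67] -/
def overToCovFin : Over X ⥤ CovFin X.carrier where
  obj Y := CovFin.mk (E := Y.left.carrier) Y.hom.toFun Y.hom.isFiniteEtale.isCoveringMap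
    fun x => (Y.hom.isFiniteEtale.finite_fibre x).to_subtype
  map g := CovFin.homMk g.left.toFun g.left.mdifferentiable.continuous (X.over_w_apply g)
  map_id _ := CovFin.hom_ext rfl
  map_comp _ _ := CovFin.hom_ext rfl

/-- The object part of `overToCovFin`: the total space is `𝕐.carrier`. [cite: HatcherAT2002, §1.3 p.67] -/
@[simp] theorem overToCovFin_obj (Y : Over X) :
    (X.overToCovFin.obj Y) = CovFin.mk (E := Y.left.carrier) Y.hom.toFun
      Y.hom.isFiniteEtale.isCoveringMap fun x => (Y.hom.isFiniteEtale.finite_fibre x).to_subtype :=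
  rfl

/-- The projection of the image of `𝕐 → 𝕏` is the structure map. [cite: HatcherAT2002, §1.3 p.67] -/
@[simp] theorem overToCovFin_obj_proj (Y : Over X) : (X.overToCovFin.obj Y).proj = Y.hom.toFun := rfl

/-- The morphism part of `overToCovFin` is the underlying map. [cite: HatcherAT2002, §1.3 p.67] -/
@[simp] theorem overToCovFin_map_apply {Y Z : Over X} (g : Y ⟶ Z) (y : Y.left.carrier) :
    (X.overToCovFin.map g).hom.left y = g.left.toFun y :=
  rfl

/-! ### §2 `overToCovFin` is fully faithful -/

/-- **Faithful**: a morphism of the slice is determined by its underlying map.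
[cite: MochizukiAbsTopIII2015, Definition 4.1 (iii) p.103] -/
theorem overToCovFin_faithful : (X.overToCovFin).Faithful where
  map_injective {Y Z} f g h := by
    ext1
    apply hom_ext
    funext y
    exact congrArg (fun k : X.overToCovFin.obj Y ⟶ X.overToCovFin.obj Z => (k.hom.left : _ → _) y) h

/-- A Riemann surface is locally connected (charts into the locally connected `ℂ`). [folklore] -/
private theorem locallyConnectedSpace_carrier : LocallyConnectedSpace X.carrier :=
  ChartedSpace.locallyConnectedSpace ℂ X.carrier

/-- **A continuous map over `𝕏^top` between the underlying covers of two objects over `𝕏` is finite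
étale**: a covering map by the tree's `IsCoveringMap.of_comp_eq` (Hatcher Ex. 1.3.16; `𝕏^top` is
locally connected), with finite fibres inside the finite fibres of the source's structure map.
[cite: HatcherAT2002, §1.3 Exercise 16 (p. 80)] -/
theorem isFiniteEtale_of_over {Y Z : Over X} (g : Y.left.carrier → Z.left.carrier) (hg : Continuous g)
    (h : ∀ y, Z.hom.toFun (g y) = Y.hom.toFun y) : IsFiniteEtale g := by
  haveI := X.locallyConnectedSpace_carrier
  refine ⟨IsCoveringMap.of_comp_eq Y.hom.isFiniteEtale.isCoveringMap Z.hom.isFiniteEtale.isCoveringMap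
    hg h, fun z => ?_⟩
  refine (Y.hom.isFiniteEtale.finite_fibre (Z.hom.toFun z)).subset fun y hy => ?_
  rw [mem_preimage, mem_singleton_iff] at hy ⊢
  rw [← h y, hy]

/-- **The morphism of the slice with a prescribed continuous underlying map over `𝕏^top`** (rigidity:
holomorphy is automatic, `HolRS.homOfOver`). [cite: MochizukiAbsTopIII2015, proof of Proposition 4.2, p.106 l.11–19] -/
def overHomMk {Y Z : Over X} (g : Y.left.carrier → Z.left.carrier) (hg : Continuous g)
    (h : ∀ y, Z.hom.toFun (g y) = Y.hom.toFun y) : Y ⟶ Z :=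
  Over.homMk (homOfOver Y.hom Z.hom g (X.isFiniteEtale_of_over g hg h) (funext h))
    (homOfOver_comp Y.hom Z.hom g _ _)

/-- The underlying map of `overHomMk g _ _` is `g`. [cite: MochizukiAbsTopIII2015, Definition 4.1 (iii) p.103] -/
@[simp] theorem overHomMk_left_toFun {Y Z : Over X} (g : Y.left.carrier → Z.left.carrier)
    (hg : Continuous g) (h : ∀ y, Z.hom.toFun (g y) = Y.hom.toFun y) :
    (X.overHomMk g hg h).left.toFun = g :=
  rfl

/-- **Full**: every morphism of finite covers over `𝕏^top` between the images of two objects over `𝕏`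
is the image of a morphism of the slice. [cite: MochizukiAbsTopIII2015, proof of Proposition 4.2, p.106 l.11–19]
[cite: HatcherAT2002, §1.3 Exercise 16 (p. 80)] -/
theorem overToCovFin_full : (X.overToCovFin).Full where
  map_surjective {Y Z} k :=
    ⟨X.overHomMk (k.hom.left : Y.left.carrier → Z.left.carrier) (CovFin.continuous_hom k)
      (fun y => CovFin.hom_over k y), CovFin.hom_ext rfl⟩

/-- **`overToCovFin` is fully faithful.** [cite: MochizukiAbsTopIII2015, proof of Proposition 4.2, p.106 l.11–19] -/
def overToCovFinFullyFaithful : (X.overToCovFin).FullyFaithful :=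
  haveI := X.overToCovFin_full
  haveI := X.overToCovFin_faithful
  Functor.FullyFaithful.ofFullyFaithful _

/-! ### §3 The essential image: connected finite covers -/

/-- An isomorphism of finite covers of `𝕏^top` induces a homeomorphism of total spaces.
[cite: HatcherAT2002, §1.3 p.67] -/
def homeoOfCovFinIso {T : Type} [TopologicalSpace T] {E F : CovFin T} (i : E ≅ F) :
    E.obj.left ≃ₜ F.obj.left :=
  TopCat.homeoOfIso ((Over.forget _).mapIso (((IsFiniteCovering T).ι).mapIso i))

/-- Connectedness of the total space is invariant under isomorphisms of finite covers.
[cite: HatcherAT2002, §1.3 p.67] -/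
theorem connectedSpace_of_covFinIso {T : Type} [TopologicalSpace T] {E F : CovFin T} (i : E ≅ F)
    [ConnectedSpace E.obj.left] : ConnectedSpace F.obj.left := by
  let e := homeoOfCovFinIso i
  rw [connectedSpace_iff_univ, ← e.range_coe, ← image_univ]
  exact isConnected_univ.image _ e.continuous.continuousOn

/-- The image of an object over `𝕏` is a connected cover (its total space is `𝕐.carrier`).
[cite: MochizukiAbsTopIII2015, Definition 4.1 (i) p.101] -/
theorem connectedSpace_overToCovFin_obj (Y : Over X) : ConnectedSpace (X.overToCovFin.obj Y).obj.left :=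
  Y.left.connectedSpace

section EssImage

variable {X}
variable (E : CovFin X.carrier) [ConnectedSpace E.obj.left]

/-- The object of the slice over `𝕏` attached to a CONNECTED finite cover `E` of `𝕏^top`: the induced
Riemann-surface structure on its total space (`HolRS.ofCover`) with its structure morphism.
[cite: Lin2011, (7.5.2.1) p.449] [cite: MochizukiAbsTopIII2015, proof of Proposition 4.2, p.106 l.11–19] -/
def overOfCovFin : Over X :=
  Over.mk (X.ofCoverHom (E := E.obj.left) (p := E.proj) E.isCoveringMap_proj
    fun x => by haveI := E.finite_fibre x; exact Set.toFinite _)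

/-- The structure map of `overOfCovFin E` is the projection of `E`. [cite: Lin2011, (7.5.2.1) p.449] -/
@[simp] theorem overOfCovFin_hom_toFun : (overOfCovFin E).hom.toFun = E.proj := rfl

/-- **The image of `overOfCovFin E` is isomorphic to `E`** (same total space, same projection).
[cite: HatcherAT2002, §1.3 p.67] -/
def overToCovFinObjIso : X.overToCovFin.obj (overOfCovFin E) ≅ E where
  hom := CovFin.homMk (fun e => e) continuous_id fun _ => rfl
  inv := CovFin.homMk (E := E) (F := X.overToCovFin.obj (overOfCovFin E)) (fun e => e) continuous_id
    fun _ => rfl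
  hom_inv_id := CovFin.hom_ext rfl
  inv_hom_id := CovFin.hom_ext rfl

end EssImage

variable {X} in
/-- **Essential image of `overToCovFin` = the connected finite covers of `𝕏^top`.**
[cite: MochizukiAbsTopIII2015, proof of Proposition 4.2, p.106 l.11–19] [cite: Lin2011, (7.5.2.1) p.449] -/
theorem mem_essImage_overToCovFin_iff (E : CovFin X.carrier) :
    X.overToCovFin.essImage E ↔ ConnectedSpace E.obj.left := by
  constructor
  · rintro ⟨Y, ⟨i⟩⟩
    haveI := X.connectedSpace_overToCovFin_obj Y
    exact connectedSpace_of_covFinIso i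
  · intro hE
    exact ⟨overOfCovFin E, ⟨overToCovFinObjIso E⟩⟩

/-! ### §4 The equivalence `Over 𝕏 ≌ {connected finite covers of 𝕏^top}` -/

/-- The property «the total space is connected» on finite covers of a space.
[cite: HatcherAT2002, §1.3 p.67–70 (connected covering spaces)] -/
def IsConnectedCover (T : Type) [TopologicalSpace T] : ObjectProperty (CovFin T) :=
  fun E => ConnectedSpace E.obj.left

/-- Unfolding `IsConnectedCover`. [cite: HatcherAT2002, §1.3 p.67] -/
theorem isConnectedCover_iff {T : Type} [TopologicalSpace T] (E : CovFin T) :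
    IsConnectedCover T E ↔ ConnectedSpace E.obj.left :=
  Iff.rfl

/-- **The forgetful functor lifted to the connected covers**, `Over 𝕏 ⥤ {connected objects of CovFin 𝕏^top}`.
[cite: MochizukiAbsTopIII2015, proof of Proposition 4.2, p.106 l.11–19] -/
def overToConnectedCovFin : Over X ⥤ (IsConnectedCover X.carrier).FullSubcategory :=
  (IsConnectedCover X.carrier).lift X.overToCovFin X.connectedSpace_overToCovFin_obj

/-- The lifted functor composed with the inclusion is `overToCovFin`. [cite: HatcherAT2002, §1.3 p.67] -/
def overToConnectedCovFinCompιIso :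
    X.overToConnectedCovFin ⋙ (IsConnectedCover X.carrier).ι ≅ X.overToCovFin :=
  Iso.refl _

/-- The lifted functor is faithful. [cite: MochizukiAbsTopIII2015, Definition 4.1 (iii) p.103] -/
theorem overToConnectedCovFin_faithful : (X.overToConnectedCovFin).Faithful :=
  haveI := X.overToCovFin_faithful
  inferInstanceAs ((IsConnectedCover X.carrier).lift X.overToCovFin _).Faithful

/-- The lifted functor is full. [cite: MochizukiAbsTopIII2015, proof of Proposition 4.2, p.106 l.11–19] -/
theorem overToConnectedCovFin_full : (X.overToConnectedCovFin).Full :=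
  haveI := X.overToCovFin_full
  inferInstanceAs ((IsConnectedCover X.carrier).lift X.overToCovFin _).Full

/-- The lifted functor is essentially surjective: every connected finite cover of `𝕏^top` carries an
object of `HolRS` over `𝕏` (`HolRS.ofCover`). [cite: Lin2011, (7.5.2.1) p.449]
[cite: MochizukiAbsTopIII2015, proof of Proposition 4.2, p.106 l.11–19] -/
theorem overToConnectedCovFin_essSurj : (X.overToConnectedCovFin).EssSurj where
  mem_essImage E := by
    haveI : ConnectedSpace E.obj.obj.left := E.property
    exact ⟨overOfCovFin E.obj,
      ⟨(IsConnectedCover X.carrier).fullyFaithfulι.preimageIso (overToCovFinObjIso E.obj)⟩⟩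

/-- **`Over 𝕏 ≌ {connected finite covering spaces of 𝕏^top}`**: the slice of `HolRS` over a connected
Riemann surface `𝕏` is equivalent, by forgetting the complex structure, to the category of connected
finite covering spaces of `𝕏^top` with continuous maps over `𝕏^top` — the classical content of
«objects that map to `X` … may be identified with [the finite étale coverings of `X`]» for the slice.
[cite: MochizukiAbsTopIII2015, proof of Proposition 4.2, p.106 l.11–19] [cite: Lin2011, (7.5.2.1) p.449]
[cite: HatcherAT2002, §1.3 p.67–70] -/
theorem overToConnectedCovFin_isEquivalence : (X.overToConnectedCovFin).IsEquivalence :=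
  haveI := X.overToConnectedCovFin_faithful
  haveI := X.overToConnectedCovFin_full
  haveI := X.overToConnectedCovFin_essSurj
  Functor.IsEquivalence.mk

/-- The equivalence `Over 𝕏 ≌ {connected finite covers of 𝕏^top}` as a bundled `Equivalence`.
[cite: MochizukiAbsTopIII2015, proof of Proposition 4.2, p.106 l.11–19] -/
def overEquivConnectedCovFin : Over X ≌ (IsConnectedCover X.carrier).FullSubcategory :=
  haveI := X.overToConnectedCovFin_isEquivalence
  X.overToConnectedCovFin.asEquivalence

end HolRS

end Literature.AnabelianGeometry.AbsoluteAnabelian
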